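import Literature.AlgebraicGeometry.HodgeTheory.AbelianVarietyHOneExactness
import Literature.AlgebraicGeometry.HodgeTheory.AbelianVarietyPullbackAlgebraicClasses
import Literature.AlgebraicGeometry.HodgeTheory.HodgeClassesIsogenyInvariance
import Literature.AlgebraicGeometry.HodgeTheory.HodgeTypeExteriorProduct
import Literature.AlgebraicGeometry.HodgeTheory.HodgeConjecture
import HarnessLib

/-!
# The Hodge conjecture descends to abelian subvarieties and to quotient abelian varieties (Poincaré's complete reducibility; van Geemen 1994 §3.6–3.7)

Family `hodge`, layer `Literature/AlgebraicGeometry/HodgeTheory`. Theorems only: no definition, no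
named fact; net debt 0; axioms standard. Written for the cell `pub-hodge-ring2` (literature seat,
generation 38; brick E15a), but general-purpose: every seat that meets an abelian subvariety or a
quotient abelian variety of a variety for which the Hodge conjecture is known can restrict the
conclusion to it.

## What is proved

For complex abelian varieties `I`, `J`:

* `hodgeClasses_algebraic_of_comp_eq_nsmul_id` — if `t : I → J`, `h : J → I` satisfy `t ≫ h = [n]`,
  `n ≠ 0` ("`I` is a direct summand of `J` up to isogeny"), then, degree by degree, the algebraicity
  of all rational `(p,p)`-classes of `J` implies that of all rational `(p,p)`-classes of `I`:
  for such a class `c` on `I`, `h^* c` is a rational `(p,p)`-class on `J`, hence algebraic, hence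
  `t^* h^* c = n^{2p} c` is algebraic (pull-backs of algebraic classes along morphisms INTO an abelian
  variety are algebraic: the tree's `map_mem_algebraicClasses_of_abelianVariety`, Fulton Cor. 19.2 (b)
  via general translates), so `c` is;
* `HodgeConjectureFor.of_comp_eq_nsmul_id` — the same for the per-variety statement
  `HodgeConjectureFor` of the summit layer;
* `HodgeConjectureFor.of_isClosedImmersion` — **HC(`J`) ⟹ HC(`I`) for every abelian subvariety
  `ι : I ↪ J`** (Poincaré: `ι ≫ p = [n]` for some `p`, the tree's
  `AbelianVariety.exists_comp_eq_nsmul_id_of_isClosedImmersion`);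
* `HodgeConjectureFor.of_surjective_hom` — **HC(`J`) ⟹ HC(`I`) for every surjective homomorphism
  `h : J ↠ I`** (quasi-section `t ≫ h = [n]`, the tree's
  `AbelianVariety.exists_comp_eq_nsmul_id_of_surjective`);
* degreewise versions `hodgeClasses_algebraic_of_isClosedImmersion` / `_of_surjective_hom`.
* (§2, rev. 2) the same three statements for `B = D` («the Hodge ring is generated by divisor classes»,
  the tree's `IsDivisorGenerated`): `IsDivisorGenerated.of_comp_eq_nsmul_id`, `.of_isClosedImmersion`,
  `.of_surjective_hom` — pull-backs of divisor classes are divisor classes (van Geemen §2.4–2.5, the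
  tree's `AbelianVariety.map_mem_divisorClassesSpan`), so `n^{2p} c = t^* h^* c ∈ Dᵖ ⊗ ℂ`.

Published statement followed: van Geemen, LNM 1594, §3.6–3.7 («Let `X ≈_isog Y`. Then the Hodge
`(p, p)`-conjecture for `X` is true if and only if [it] is true for `Y`», proved by pulling back
cycles and classes; with Poincaré's complete reducibility — Mumford §19 Thm. 1, the tree's THEOREM
`AbelianVariety.poincare_complete_reducibility` — an abelian subvariety / quotient is an isogeny
direct summand, and the argument applies to the summand: Lange–Birkenhake Cor. 2.4.24, Prop. 1.1.12,
Prop. 1.1.15, the norm-endomorphism remark 5.3.4). The only non-formal input beyond Poincaré is the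
pull-back stability of algebraic classes into an abelian variety (`map_mem_algebraicClasses_of_abelianVariety`).

## References

* [vanGeemen1994HodgeAV] B. van Geemen, *An introduction to the Hodge conjecture for abelian
  varieties*, LNM 1594 (1994), §3.5–3.7, Lemma 3.7 (p. 236).
* [MumfordAV1970] D. Mumford, *Abelian Varieties* (1970), §19 Thm. 1 (pp. 173–174), Remark p. 169,
  §1 (3).
* [LangeBirkenhake1992] H. Lange, Ch. Birkenhake, *Complex Abelian Varieties* (1992), Prop. 1.1.12,
  Prop. 1.1.15, Cor. 2.4.24, §5.3.
* [Fulton1998] W. Fulton, *Intersection Theory*, 2nd ed. (1998), §19.2 Cor. 19.2 (b).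
-/

noncomputable section

open CategoryTheory CategoryTheory.Limits AlgebraicGeometry

namespace Literature.AlgebraicGeometry.HodgeTheory

open Literature.AlgebraicTopology.SingularHomology Literature.AlgebraicGeometry.Motives
  Literature.AlgebraicGeometry.Motives.AbelianVariety
open Literature.Barriers.HodgeConjecture (divisorClassesSpan)

variable {I J : Motives.AbelianVariety ℂ}

/-- **Algebraicity of Hodge classes passes to an isogeny direct summand, degree by degree**: if
`t : I → J` and `h : J → I` satisfy `t ≫ h = [n]` with `n ≠ 0`, and every rational `(p,p)`-class on
`J` is algebraic, then every rational `(p,p)`-class `c` on `I` is algebraic — `h^* c` is rational of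
type `(p,p)` on `J`, hence algebraic, so `t^* h^* c = n^{2p} • c` is algebraic (pull-back into an
abelian variety, Fulton Cor. 19.2 (b)), and `n^{2p} ≠ 0`. [cite: vanGeemen1994HodgeAV, §3.6–3.7 Lemma 3.7 (p. 236)]
[cite: Fulton1998, §19.2 Cor. 19.2 (b)] [cite: MumfordAV1970, §1 (3) and §19 Remark p. 169] -/
theorem hodgeClasses_algebraic_of_comp_eq_nsmul_id (t : I ⟶ J) (h : J ⟶ I) {n : ℕ} (hn : n ≠ 0)
    (hth : t ≫ h = n • 𝟙 I) {p : ℕ}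
    (hJ : ∀ c' : complexBetti J.X (2 * p), IsRationalClass c' →
      IsOfHodgeType J.dim J.X (2 * p) p p c' → c' ∈ algebraicClasses J.X p)
    (c : complexBetti I.X (2 * p)) (hc : IsRationalClass c)
    (hpp : IsOfHodgeType I.dim I.X (2 * p) p p c) : c ∈ algebraicClasses I.X p := by
  have hI : IsSmoothProjective I.dim I.X := AbelianVariety.isSmoothProjective_holds
  have hJsp : IsSmoothProjective J.dim J.X := AbelianVariety.isSmoothProjective_holds
  -- `h^* c` is a rational `(p,p)`-class on `J`, hence algebraic
  have h1 : complexBetti.map h.hom.hom.hom (2 * p) c ∈ algebraicClasses J.X p :=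
    hJ _ (hc.map _) (hpp.map_of_isSmoothProjective hJsp hI h.hom.hom.hom)
  -- its pull-back along `t` is algebraic on `I` and equals `n^{2p} • c`
  have h2 : complexBetti.map t.hom.hom.hom (2 * p) (complexBetti.map h.hom.hom.hom (2 * p) c) ∈
      algebraicClasses I.X p :=
    map_mem_algebraicClasses_of_abelianVariety hI J t.hom.hom.hom h1
  rw [complexBetti_map_map_of_comp_eq_nsmul_id hth] at h2
  have hn' : ((n : ℂ) ^ (2 * p)) ≠ 0 := pow_ne_zero _ (Nat.cast_ne_zero.2 hn)
  have h3 := Submodule.smul_mem (algebraicClasses I.X p) (((n : ℂ) ^ (2 * p))⁻¹) h2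
  rwa [smul_smul, inv_mul_cancel₀ hn', one_smul] at h3

/-- **The Hodge conjecture passes to an isogeny direct summand**: `t ≫ h = [n]`, `n ≠ 0`, and
HC(`J`) imply HC(`I`) (the per-variety statement `HodgeConjectureFor` of the summit layer; the Hodge
model of `I` is the tree's `nonempty_hodgeModel_holds`). [cite: vanGeemen1994HodgeAV, §3.6–3.7 Lemma 3.7 (p. 236)]
[cite: MumfordAV1970, §19 Remark p. 169] -/
theorem HodgeConjectureFor.of_comp_eq_nsmul_id (t : I ⟶ J) (h : J ⟶ I) {n : ℕ} (hn : n ≠ 0)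
    (hth : t ≫ h = n • 𝟙 I) (hJ : HodgeConjectureFor J.dim J.X) : HodgeConjectureFor I.dim I.X :=
  ⟨nonempty_hodgeModel_holds AbelianVariety.isSmoothProjective_holds, fun _ c hc hpp =>
    hodgeClasses_algebraic_of_comp_eq_nsmul_id t h hn hth (hJ.2 _) c hc hpp⟩

/-- **Rational `(p,p)`-classes on an abelian subvariety are algebraic if those of the ambient abelian
variety are** (Poincaré's complete reducibility: an abelian subvariety `ι : I ↪ J` is a direct summand
up to isogeny, `ι ≫ p = [n]`, the tree's `AbelianVariety.exists_comp_eq_nsmul_id_of_isClosedImmersion`).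
[cite: MumfordAV1970, §19 Thm. 1 (pp. 173–174)] [cite: LangeBirkenhake1992, Cor. 2.4.24 and Prop. 1.1.15]
[cite: vanGeemen1994HodgeAV, §3.6–3.7 Lemma 3.7 (p. 236)] -/
theorem hodgeClasses_algebraic_of_isClosedImmersion (ι : I ⟶ J) [IsClosedImmersion (Hom.toSchemeHom ι)]
    {p : ℕ} (hJ : ∀ c' : complexBetti J.X (2 * p), IsRationalClass c' →
      IsOfHodgeType J.dim J.X (2 * p) p p c' → c' ∈ algebraicClasses J.X p)
    (c : complexBetti I.X (2 * p)) (hc : IsRationalClass c)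
    (hpp : IsOfHodgeType I.dim I.X (2 * p) p p c) : c ∈ algebraicClasses I.X p := by
  obtain ⟨q, n, hn, hq⟩ := exists_comp_eq_nsmul_id_of_isClosedImmersion ι
  exact hodgeClasses_algebraic_of_comp_eq_nsmul_id ι q hn hq hJ c hc hpp

/-- **The Hodge conjecture descends to abelian subvarieties**: HC(`J`) ⟹ HC(`I`) for every closed
immersion `ι : I ↪ J` of complex abelian varieties that is a homomorphism.
[cite: MumfordAV1970, §19 Thm. 1 (pp. 173–174)] [cite: vanGeemen1994HodgeAV, §3.6–3.7 Lemma 3.7 (p. 236)] -/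
theorem HodgeConjectureFor.of_isClosedImmersion (ι : I ⟶ J) [IsClosedImmersion (Hom.toSchemeHom ι)]
    (hJ : HodgeConjectureFor J.dim J.X) : HodgeConjectureFor I.dim I.X := by
  obtain ⟨q, n, hn, hq⟩ := exists_comp_eq_nsmul_id_of_isClosedImmersion ι
  exact HodgeConjectureFor.of_comp_eq_nsmul_id ι q hn hq hJ

/-- **Rational `(p,p)`-classes on a quotient abelian variety are algebraic if those of the source
are** (a surjective homomorphism `h : J ↠ I` has a quasi-section `t ≫ h = [n]`, the tree's
`AbelianVariety.exists_comp_eq_nsmul_id_of_surjective`: a Poincaré complement of `(Ker h)⁰` maps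
isogenously onto `I`). [cite: MumfordAV1970, §19 Thm. 1 and Remark p. 169]
[cite: LangeBirkenhake1992, Prop. 1.1.12, Prop. 1.1.15 and Cor. 2.4.24] [cite: vanGeemen1994HodgeAV, §3.6–3.7 Lemma 3.7 (p. 236)] -/
theorem hodgeClasses_algebraic_of_surjective_hom (h : J ⟶ I) [Surjective (Hom.toSchemeHom h)]
    {p : ℕ} (hJ : ∀ c' : complexBetti J.X (2 * p), IsRationalClass c' →
      IsOfHodgeType J.dim J.X (2 * p) p p c' → c' ∈ algebraicClasses J.X p)
    (c : complexBetti I.X (2 * p)) (hc : IsRationalClass c)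
    (hpp : IsOfHodgeType I.dim I.X (2 * p) p p c) : c ∈ algebraicClasses I.X p := by
  obtain ⟨t, n, hn, ht⟩ := exists_comp_eq_nsmul_id_of_surjective h
  exact hodgeClasses_algebraic_of_comp_eq_nsmul_id t h hn ht hJ c hc hpp

/-- **The Hodge conjecture descends to quotient abelian varieties**: HC(`J`) ⟹ HC(`I`) for every
surjective homomorphism `h : J ↠ I` of complex abelian varieties (any dimensions; compare the tree's
`HodgeConjectureFor.of_surjective`, which needs `dim J = dim I`).
[cite: MumfordAV1970, §19 Thm. 1 and Remark p. 169] [cite: vanGeemen1994HodgeAV, §3.6–3.7 Lemma 3.7 (p. 236)] -/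
theorem HodgeConjectureFor.of_surjective_hom (h : J ⟶ I) [Surjective (Hom.toSchemeHom h)]
    (hJ : HodgeConjectureFor J.dim J.X) : HodgeConjectureFor I.dim I.X := by
  obtain ⟨t, n, hn, ht⟩ := exists_comp_eq_nsmul_id_of_surjective h
  exact HodgeConjectureFor.of_comp_eq_nsmul_id t h hn ht hJ

/-- **Factors of a product** (a special case, also in the tree as `hodgeConjectureFor_left_of_prod` /
`_right_of_prod` with a different proof): HC(`I × J`) ⟹ HC(`I`), through the split surjection
`fst : I × J ↠ I`, `(𝟙, 0) ≫ fst = 𝟙 = [1]`. [cite: vanGeemen1994HodgeAV, §3.6–3.7 Lemma 3.7 (p. 236)] -/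
theorem HodgeConjectureFor.of_prod_fst (hIJ : HodgeConjectureFor (I.prod J).dim (I.prod J).X) :
    HodgeConjectureFor I.dim I.X :=
  HodgeConjectureFor.of_comp_eq_nsmul_id (AbelianVariety.prodLift (𝟙 I) 0) (AbelianVariety.fst I J)
    one_ne_zero (by rw [AbelianVariety.prodLift_fst, one_smul]) hIJ


/-! ### §2 `B = D` descends to abelian subvarieties and quotients -/

/-- **`B = D` passes to an isogeny direct summand**: if `t : I → J`, `h : J → I` satisfy `t ≫ h = [n]`,
`n ≠ 0`, and the Hodge ring of `J` is generated by divisor classes (`IsDivisorGenerated J`), then so is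
the Hodge ring of `I`: for a rational `(p,p)`-class `c` on `I`, `h^* c ∈ Bᵖ(J) = Dᵖ(J) ⊗ ℂ`, and
`t^* h^* c = n^{2p} c ∈ t^*(Dᵖ(J) ⊗ ℂ) ⊆ Dᵖ(I) ⊗ ℂ` (pull-backs of products of divisor classes are
products of divisor classes). [cite: vanGeemen1994HodgeAV, §2.4–2.5 (p. 235) and §3.6–3.7 (p. 236)]
[cite: MumfordAV1970, §19 Remark p. 169] -/
theorem IsDivisorGenerated.of_comp_eq_nsmul_id (t : I ⟶ J) (h : J ⟶ I) {n : ℕ} (hn : n ≠ 0)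
    (hth : t ≫ h = n • 𝟙 I) (hJ : IsDivisorGenerated J) : IsDivisorGenerated I := by
  intro p c hc hpp
  have h1 := AbelianVariety.mapsTo_hodgeClasses h p ⟨hc, hpp⟩
  have h2 : complexBetti.map t.hom.hom.hom (2 * p) (complexBetti.map h.hom.hom.hom (2 * p) c) ∈
      divisorClassesSpan I.X I.dim p :=
    AbelianVariety.map_mem_divisorClassesSpan t (hJ p _ h1.1 h1.2)
  rw [complexBetti_map_map_of_comp_eq_nsmul_id hth] at h2
  have hn' : ((n : ℂ) ^ (2 * p)) ≠ 0 := pow_ne_zero _ (Nat.cast_ne_zero.2 hn)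
  have h3 := Submodule.smul_mem (divisorClassesSpan I.X I.dim p) (((n : ℂ) ^ (2 * p))⁻¹) h2
  rwa [smul_smul, inv_mul_cancel₀ hn', one_smul] at h3

/-- **`B = D` descends to abelian subvarieties**: `IsDivisorGenerated J → IsDivisorGenerated I` for
every closed immersion `ι : I ↪ J` that is a homomorphism (Poincaré: `ι ≫ p = [n]`).
[cite: MumfordAV1970, §19 Thm. 1 (pp. 173–174)] [cite: vanGeemen1994HodgeAV, §2.4–2.5 and §3.6–3.7] -/
theorem IsDivisorGenerated.of_isClosedImmersion (ι : I ⟶ J) [IsClosedImmersion (Hom.toSchemeHom ι)]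
    (hJ : IsDivisorGenerated J) : IsDivisorGenerated I := by
  obtain ⟨q, n, hn, hq⟩ := exists_comp_eq_nsmul_id_of_isClosedImmersion ι
  exact IsDivisorGenerated.of_comp_eq_nsmul_id ι q hn hq hJ

/-- **`B = D` descends to quotient abelian varieties**: `IsDivisorGenerated J → IsDivisorGenerated I`
for every surjective homomorphism `h : J ↠ I` (quasi-section `t ≫ h = [n]`).
[cite: MumfordAV1970, §19 Thm. 1 and Remark p. 169] [cite: vanGeemen1994HodgeAV, §2.4–2.5 and §3.6–3.7] -/
theorem IsDivisorGenerated.of_surjective_hom (h : J ⟶ I) [Surjective (Hom.toSchemeHom h)]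
    (hJ : IsDivisorGenerated J) : IsDivisorGenerated I := by
  obtain ⟨t, n, hn, ht⟩ := exists_comp_eq_nsmul_id_of_surjective h
  exact IsDivisorGenerated.of_comp_eq_nsmul_id t h hn ht hJ

end Literature.AlgebraicGeometry.HodgeTheory

end
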